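import Summits.HodgeConjecture.HodgeConjecture.Theorems.Ring2WeilCoverageWeilGramLevel84Principal
import Summits.HodgeConjecture.HodgeConjecture.Theorems.Ring2WeilCoverageTypeNormSignLevelsG12B
import Summits.HodgeConjecture.HodgeConjecture.Theorems.Ring2WeilCoverageTypeNormSign
import HarnessLib

/-!
# Weil-type family coverage — THE COMPONENT LAW FOR PRINCIPAL-IDEAL TYPES ON `ℤ[ζ₈₄]` (`g = 12`, all-YES level `84`):
# for EVERY real integer `ϖ₀ ≠ 0` of `ℚ(ζ₈₄)⁺` and EVERY skew `ζ′` of type `(ϖ₀)`, **`det a(ζ′, s_d) = N_{K⁺/ℚ}(ϖ₀)·det a(ξ, s_d)`**;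
# with the norm-sign law: **every `ϖ₀` with `N(ϖ₀) > 0` puts `ℤ[ζ₈₄]`-CM points of type `(ϖ₀)` on the class `[N(ϖ₀)]` of
# `ℚˣ/Nm(K_dˣ)`, for every `K_d ⊂ ℚ(ζ₈₄)` and every `K_d`-balanced CM type**

research route conditional on HC_CM; not a corollary; Q11.4-sentence-2 already refuted in dim ≥ 3.

Ring 2, WEIL-TYPE FAMILY-COVERAGE CENSUS (`HOME/WEIL-FAMILY-COVERAGE.md` `## b01`, block b01.50 (C); owner ring2-b01), part 198 of
the `Ring2WeilCoverage*` series; continues part 182 (`…Level84Principal`: the `θ^i` basis and the principal determinants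
`det a(ξ, i) = 4096`, `det a(ξ, s₃) = 2985984`, `det a(ξ, s₇) = 481890304`, `det a(ξ, s₂₁) = 351298031616`) and part 56f (`…TypeNormSignLevelsG12B`: the norm-sign law at `84`).
The type-SPECIFIC files of this block (parts 183–194: the types `(π₂π₄₇)` at `48`, `(π₂π₇₉)` at `40`) computed `N(ϖ)` from two
Gram determinants; this file is the LAW behind them, quantified over ALL `ϖ₀ ∈ 𝓞 K⁺ ∖ 0`: Shimura's divisors of type `(ϖ₀)` are
the `X_{uϖ₀ξ}`, `u` a real unit ([Shimura1998 §14.3 Prop. 5]; part 48′ `isOfType_one_mul_xi` / part 55 `isOfType_realMul`), THEOREM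
L (i) at `84` (part 57 `norm_realUnits_pos_eightyFour`) makes `N(u) = 1`, and part 82 `det_realPart_mul` gives
`det a(ϖ₀ξ, s) = N(ϖ₀)·det a(ξ, s)`.  Consequence (S-pencil reading in census words, b01.50 (C)): the classes in `ℚˣ/Nm(K_dˣ)`
realised by `ι`-compatibly polarised `ℤ[ζ₈₄]`-CM points of principal-ideal type are exactly the `[N(ϖ₀)]`, `N(ϖ₀) > 0`
(`n = 6` even: `det a(ξ, s_d)` is a square).

* per `K_d` (`d = 1, 3, 7, 21`): **`det_realPart_type_span_<s>`** (the law), **`exists_type_span_<s>_det`** (CENSUS FORM: for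
  every `ϖ₀` with `N(ϖ₀) > 0` and every `K_d`-balanced `Φ`, a `Φ`-positive divisor of type `(ϖ₀)` EXISTS — part 56f
  `exists_type_iff_norm_pos_eightyFour_<d>` — and every such has `det a = N(ϖ₀)·det a(ξ, s_d)`), **`mk_mul_det_xi_<s>`** (`[N·det a(ξ, s_d)] = [N]`
  in `ℚˣ/Nm(K_dˣ)` for every `N ≠ 0`: the class of a type-`(ϖ₀)` point is `[N(ϖ₀)]`).

HONEST FRAMING as parts 82–194: kernel statements about traces and norms in `ℚ(ζ₈₄)`, Shimura's divisors of type `(K; Φ; (ϖ₀))`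
on `ℂ^Φ/Φ(ℤ[ζ₈₄])` and norm classes; nothing about Hodge classes, `W_K`, general members or HC; `HC_CM` is used nowhere.
No `def`, no named fact, no `sorry`.

References: [cite: vanGeemen1994HodgeAV, Lemma 5.2 (2)–(4), 5.4 and (5.4.1)]; [cite: Shimura1998, §14.3 Prop. 4–5,
pp. 103–104]; census b01.42 / b01.50 (seat-derived).
-/

noncomputable section

open Polynomial NumberField Module
open scoped nonZeroDivisors

namespace Summit.HodgeConjecture.Ring2WeilCoverage.WeilGramLevel84TypeLaw

open Literature.AlgebraicGeometry.VanGeemen1994 (weilField weilNormResidueGroup)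
open Literature.AlgebraicGeometry.Motives (CMType normUnitsSubgroup)
open Literature.NumberTheory.ComplexMultiplication
open Summit.HodgeConjecture.Ring2WeilCoverage.WeilGramTools
open Summit.HodgeConjecture.Ring2WeilCoverage.WeilGramCMPoint
open Summit.HodgeConjecture.Ring2WeilCoverage.RealUnitNormHalfSystems (complexConj_eq_inv)
open Summit.HodgeConjecture.Ring2WeilCoverage.CyclotomicPrincipalObstruction (complexConj_xi)
open Summit.HodgeConjecture.Ring2WeilCoverage.CyclotomicDifferent (isOfType_one_xi_top xi_ne_zero)
open Summit.HodgeConjecture.HodgeConjecture.Ring2.WeilCoverage (mk_neg_eq_split_of_odd mk_neg_ne_split_of_odd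
  mk_eq_split_of_even mk_ne_split_of_even mem_normUnitsSubgroup_of_sq_add_mul_sq natCast_not_mem_normUnitsSubgroup_of_ramified)
open Summit.HodgeConjecture.HodgeConjecture.Ring2.Hypotheses (splitDiscriminantClass)
open Summit.HodgeConjecture.Ring2WeilCoverage.WeilGramLevel84
open Summit.HodgeConjecture.Ring2WeilCoverage.WeilGramLevel84Principal (exists_basis_thetaPow)
open Summit.HodgeConjecture.Ring2WeilCoverage.WeilGramLevel84SqrtNegOneGram (det_realPart_xi_sqrtNegOne)
open Summit.HodgeConjecture.Ring2WeilCoverage.WeilGramLevel84SqrtNegThreeGram (det_realPart_xi_sqrtNegThree)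
open Summit.HodgeConjecture.Ring2WeilCoverage.WeilGramLevel84SqrtNegSevenGram (det_realPart_xi_sqrtNegSeven)
open Summit.HodgeConjecture.Ring2WeilCoverage.WeilGramLevel84SqrtNegTwentyOneGram (det_realPart_xi_sqrtNegTwentyOne)
open Summit.HodgeConjecture.Ring2WeilCoverage.RealUnitNormTwelve (norm_realUnits_pos_eightyFour)
open Summit.HodgeConjecture.Ring2WeilCoverage.TypeNormSignLevelsG12B (exists_type_iff_norm_pos_eightyFour_sqrt_neg_one exists_type_iff_norm_pos_eightyFour_sqrt_neg_three exists_type_iff_norm_pos_eightyFour_sqrt_neg_seven exists_type_iff_norm_pos_eightyFour_sqrt_neg_twentyOne)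
open Summit.HodgeConjecture.Ring2WeilCoverage.TypeNormSign (complexConj_realMul isOfType_realMul algebraMap_ringOfIntegers_ne_zero)
variable {K : Type} [Field K] [NumberField K] {ζ : K}

/-- `𝐞(t) = exp(2πi t/n) ∈ ℂ` (`ZMod.toCircle`). -/
local notation3 (prettyPrint := false) "𝐞 " t:max => ((ZMod.toCircle t : Circle) : ℂ)

/-- the residue set `S_Φ` read at level `84`. -/
local notation3 (prettyPrint := false) "SΦ[" Φ "," z "]" =>
  (Finset.univ.filter fun t : ZMod 84 => ∃ σ ∈ (Φ : CMType K).1, σ (z : K) = 𝐞 t)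

/-- the image in `K` of an integer `ϖ₀` of the maximal real subfield (part 55's notation). -/
local notation3 (prettyPrint := false) "𝓇 " x:max => (algebraMap (𝓞 (maximalRealSubfield K)) K x)

/-! ### §1 `K_d = ℚ(i)` (`s = i`): the law `det a(ζ′) = N(ϖ₀)·4096`, census form for every `N(ϖ₀) > 0`, class `[N(ϖ₀)]` -/

/-- **THE COMPONENT LAW at `84` for `K_d = ℚ(i)`**: for EVERY real integer `ϖ₀ ≠ 0` of `ℚ(ζ_84)⁺` and EVERY skew `ζ′` of
type `(ϖ₀)` on `ℤ[ζ_84]` (`IsOfType 1 ζ′ (ϖ₀)`; `ζ′ = u·ϖ₀ξ`, `u` a real unit, `N(u) = 1` by THEOREM L (i) at `84`), the Gram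
determinant of `(E_ζ′, i)` in the frame `θ^i` is **`N_{K⁺/ℚ}(ϖ₀)·4096`** (`4096 = det a(ξ, i)`, part 178): the point lies on
the class `[N(ϖ₀)]` of `ℚˣ/Nm(ℚ(i)ˣ)`.
research route conditional on HC_CM; not a corollary; Q11.4-sentence-2 already refuted in dim ≥ 3. [cite: vanGeemen1994HodgeAV, Lemma 5.2 (3)–(4) and (5.4.1)] [cite: Shimura1998, §14.3 Prop. 4–5, pp. 103–104] -/
theorem det_realPart_type_span_sqrtNegOne [IsCyclotomicExtension {84} ℚ K] [IsCMField K] (hζ : IsPrimitiveRoot ζ 84)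
    (ϖ₀ : 𝓞 (maximalRealSubfield K)) (hϖ0 : ϖ₀ ≠ 0)
    {ζ' : K} (hζ' : IsCMField.complexConj K ζ' = -ζ')
    (hT : CMTypeLattice.IsOfType (1 : (FractionalIdeal (𝓞 K)⁰ K)ˣ) ζ' (Ideal.span {ϖ₀}))
    {x : Fin 12 → K} (hx : ∀ i, x i = (ζ + ζ⁻¹) ^ (i : ℕ)) {a : Matrix (Fin 12) (Fin 12) ℚ}
    (ha : ∀ i j, a i j = Algebra.trace ℚ K (ζ' * x i * IsCMField.complexConj K ((ζ ^ 21) * x j))) :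
    a.det = Algebra.norm ℚ ((ϖ₀ : maximalRealSubfield K)) * 4096 := by
  obtain ⟨ωb, hωb⟩ := exists_basis_thetaPow hζ
  have hx' : ∀ i, x i = (ωb i : K) := fun i => (hx i).trans (hωb i).symm
  have hξ := complexConj_xi_eightyFour hζ
  have hsk := complexConj_realMul ϖ₀ hξ
  have h0 := mul_ne_zero (algebraMap_ringOfIntegers_ne_zero (K := K) hϖ0) (xi_ne_zero hζ 11)
  have hT₀ : CMTypeLattice.IsOfType (1 : (FractionalIdeal (𝓞 K)⁰ K)ˣ) (𝓇 ϖ₀ * (ζ ^ 11 * (aeval ζ (derivative (cyclotomic 84 ℚ)))⁻¹)) (Ideal.span {ϖ₀}) := by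
    have h := isOfType_realMul (𝔪 := 1) ϖ₀ (isOfType_one_xi_top hζ 11)
    rwa [Ideal.mul_top] at h
  rw [det_realPart_eq_of_isOfType ωb (complexConj_sqrtNegOne hζ) hx' (norm_realUnits_pos_eightyFour hζ) hsk h0 hζ' hT₀ hT (fun i j => rfl) ha]
  obtain ⟨γ₀, hγ⟩ := exists_real_eq_mul_of_skew hξ (complexConj_sqrtNegOne hζ)
  have e : ((ϖ₀ : maximalRealSubfield K) : K) = 𝓇 ϖ₀ := by
    rw [IsScalarTower.algebraMap_apply (𝓞 (maximalRealSubfield K)) (maximalRealSubfield K) K]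
    rfl
  have hmul := det_realPart_mul ωb (complexConj_sqrtNegOne hζ) hx' hγ (β₀ := (ϖ₀ : maximalRealSubfield K))
    (a := Matrix.of fun i j => Algebra.trace ℚ K ((ζ ^ 11 * (aeval ζ (derivative (cyclotomic 84 ℚ)))⁻¹) * x i * IsCMField.complexConj K ((ζ ^ 21) * x j)))
    (a' := Matrix.of fun i j => Algebra.trace ℚ K (𝓇 ϖ₀ * (ζ ^ 11 * (aeval ζ (derivative (cyclotomic 84 ℚ)))⁻¹) * x i * IsCMField.complexConj K ((ζ ^ 21) * x j)))
    (fun i j => rfl) (fun i j => by rw [Matrix.of_apply, e])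
  have hD := det_realPart_xi_sqrtNegOne hζ hx
    (a := Matrix.of fun i j => Algebra.trace ℚ K ((ζ ^ 11 * (aeval ζ (derivative (cyclotomic 84 ℚ)))⁻¹) * x i * IsCMField.complexConj K ((ζ ^ 21) * x j))) (fun i j => rfl)
  rw [hD] at hmul
  exact hmul

open scoped Classical in
/-- **CENSUS FORM OF THE LAW** (`K_d = ℚ(i)` at `84`): for EVERY real integer `ϖ₀` with `N_{K⁺/ℚ}(ϖ₀) > 0` and every CM type
`Φ` of `ℚ(ζ_84)` balanced for `N_K = {11, 19, 23, 31, 43, 47, 55, 59, 67, 71, 79, 83}` (`i`-signature `(6,6)`), `ℂ^Φ/Φ(ℤ[ζ_84])` CARRIES a `Φ`-positive divisor of type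
`(K; Φ; (ϖ₀))` (the norm-sign law, part 56f `exists_type_iff_norm_pos_eightyFour_sqrt_neg_one`) and EVERY such divisor has Gram determinant
`N(ϖ₀)·4096` in the frame `θ^i` — class `[N(ϖ₀)]`: **every positive norm from `ℤ[ζ_84]⁺` is the component of a
`ℤ[ζ_84]`-CM point of Weil type, on every balanced CM type.**
research route conditional on HC_CM; not a corollary; Q11.4-sentence-2 already refuted in dim ≥ 3. [cite: vanGeemen1994HodgeAV, Lemma 5.2 (3)–(4) and (5.4.1)] [cite: Shimura1998, §14.3 Prop. 4–5, pp. 103–104] -/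
theorem exists_type_span_sqrtNegOne_det [IsCyclotomicExtension {84} ℚ K] [IsCMField K]
    (hζ : IsPrimitiveRoot ζ 84) (Φ : CMType K)
    (hbal : 2 * (SΦ[Φ, ζ] ∩ ({11, 19, 23, 31, 43, 47, 55, 59, 67, 71, 79, 83} : Finset (ZMod 84))).card = (SΦ[Φ, ζ]).card)
    (ϖ₀ : 𝓞 (maximalRealSubfield K)) (hpos : 0 < Algebra.norm ℚ ((ϖ₀ : maximalRealSubfield K))) :
    ∃ ζ' : K, IsCMField.complexConj K ζ' = -ζ' ∧ (∀ φ : Φ.1, 0 < (φ.1 ζ').im) ∧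
      CMTypeLattice.IsOfType (1 : (FractionalIdeal (𝓞 K)⁰ K)ˣ) ζ' (Ideal.span {ϖ₀}) ∧
      ∀ (x : Fin 12 → K), (∀ i, x i = (ζ + ζ⁻¹) ^ (i : ℕ)) → ∀ a : Matrix (Fin 12) (Fin 12) ℚ,
        (∀ i j, a i j = Algebra.trace ℚ K (ζ' * x i * IsCMField.complexConj K ((ζ ^ 21) * x j))) →
        a.det = Algebra.norm ℚ ((ϖ₀ : maximalRealSubfield K)) * 4096 := by
  have hϖ0 : ϖ₀ ≠ 0 := by
    rintro rfl
    simp at hpos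
  obtain ⟨ζ', h1, h2, h3⟩ := (exists_type_iff_norm_pos_eightyFour_sqrt_neg_one hζ Φ hbal hϖ0).mpr hpos
  exact ⟨ζ', h1, h2, h3, fun x hx a ha => det_realPart_type_span_sqrtNegOne hζ ϖ₀ hϖ0 h1 h3 hx ha⟩

/-- **`[N·4096] = [N]` in `ℚˣ/Nm(ℚ(i)ˣ)`** for every rational `N ≠ 0` (`4096 = det a(ξ, i)` is `64² + 1·0²`, a norm): the class of a
type-`(ϖ₀)` point is `[N_{K⁺/ℚ}(ϖ₀)]`, i.e. its census row is read off the norm alone (`T(N(ϖ₀))`).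
research route conditional on HC_CM; not a corollary; Q11.4-sentence-2 already refuted in dim ≥ 3. [cite: vanGeemen1994HodgeAV, 5.4 and (5.4.1)] -/
theorem mk_mul_det_xi_sqrtNegOne (N : ℚ) (hN : N ≠ 0) :
    (QuotientGroup.mk (Units.mk0 (N * 4096) (mul_ne_zero hN (by norm_num))) : weilNormResidueGroup 1) =
      QuotientGroup.mk (Units.mk0 N hN) := by
  rw [QuotientGroup.eq]
  have e : (Units.mk0 (N * 4096) (mul_ne_zero hN (by norm_num)))⁻¹ * Units.mk0 N hN =
      Units.mk0 ((1 / 4096 : ℚ)) (by norm_num) := by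
    ext
    simp only [Units.val_mul, Units.val_inv_eq_inv_val, Units.val_mk0]
    field_simp
  rw [e]
  exact mem_normUnitsSubgroup_of_sq_add_mul_sq _ ((64 / 4096) : ℚ) (0 : ℚ) (by norm_num)

/-! ### §2 `K_d = ℚ(√−3)` (`s = s₃`): the law `det a(ζ′) = N(ϖ₀)·2985984`, census form for every `N(ϖ₀) > 0`, class `[N(ϖ₀)]` -/

/-- **THE COMPONENT LAW at `84` for `K_d = ℚ(√−3)`**: for EVERY real integer `ϖ₀ ≠ 0` of `ℚ(ζ_84)⁺` and EVERY skew `ζ′` of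
type `(ϖ₀)` on `ℤ[ζ_84]` (`IsOfType 1 ζ′ (ϖ₀)`; `ζ′ = u·ϖ₀ξ`, `u` a real unit, `N(u) = 1` by THEOREM L (i) at `84`), the Gram
determinant of `(E_ζ′, s₃)` in the frame `θ^i` is **`N_{K⁺/ℚ}(ϖ₀)·2985984`** (`2985984 = det a(ξ, s₃)`, part 179): the point lies on
the class `[N(ϖ₀)]` of `ℚˣ/Nm(ℚ(√−3)ˣ)`.
research route conditional on HC_CM; not a corollary; Q11.4-sentence-2 already refuted in dim ≥ 3. [cite: vanGeemen1994HodgeAV, Lemma 5.2 (3)–(4) and (5.4.1)] [cite: Shimura1998, §14.3 Prop. 4–5, pp. 103–104] -/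
theorem det_realPart_type_span_sqrtNegThree [IsCyclotomicExtension {84} ℚ K] [IsCMField K] (hζ : IsPrimitiveRoot ζ 84)
    (ϖ₀ : 𝓞 (maximalRealSubfield K)) (hϖ0 : ϖ₀ ≠ 0)
    {ζ' : K} (hζ' : IsCMField.complexConj K ζ' = -ζ')
    (hT : CMTypeLattice.IsOfType (1 : (FractionalIdeal (𝓞 K)⁰ K)ˣ) ζ' (Ideal.span {ϖ₀}))
    {x : Fin 12 → K} (hx : ∀ i, x i = (ζ + ζ⁻¹) ^ (i : ℕ)) {a : Matrix (Fin 12) (Fin 12) ℚ}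
    (ha : ∀ i j, a i j = Algebra.trace ℚ K (ζ' * x i * IsCMField.complexConj K ((1 + 2 * ζ ^ 28) * x j))) :
    a.det = Algebra.norm ℚ ((ϖ₀ : maximalRealSubfield K)) * 2985984 := by
  obtain ⟨ωb, hωb⟩ := exists_basis_thetaPow hζ
  have hx' : ∀ i, x i = (ωb i : K) := fun i => (hx i).trans (hωb i).symm
  have hξ := complexConj_xi_eightyFour hζ
  have hsk := complexConj_realMul ϖ₀ hξ
  have h0 := mul_ne_zero (algebraMap_ringOfIntegers_ne_zero (K := K) hϖ0) (xi_ne_zero hζ 11)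
  have hT₀ : CMTypeLattice.IsOfType (1 : (FractionalIdeal (𝓞 K)⁰ K)ˣ) (𝓇 ϖ₀ * (ζ ^ 11 * (aeval ζ (derivative (cyclotomic 84 ℚ)))⁻¹)) (Ideal.span {ϖ₀}) := by
    have h := isOfType_realMul (𝔪 := 1) ϖ₀ (isOfType_one_xi_top hζ 11)
    rwa [Ideal.mul_top] at h
  rw [det_realPart_eq_of_isOfType ωb (complexConj_sqrtNegThree hζ) hx' (norm_realUnits_pos_eightyFour hζ) hsk h0 hζ' hT₀ hT (fun i j => rfl) ha]
  obtain ⟨γ₀, hγ⟩ := exists_real_eq_mul_of_skew hξ (complexConj_sqrtNegThree hζ)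
  have e : ((ϖ₀ : maximalRealSubfield K) : K) = 𝓇 ϖ₀ := by
    rw [IsScalarTower.algebraMap_apply (𝓞 (maximalRealSubfield K)) (maximalRealSubfield K) K]
    rfl
  have hmul := det_realPart_mul ωb (complexConj_sqrtNegThree hζ) hx' hγ (β₀ := (ϖ₀ : maximalRealSubfield K))
    (a := Matrix.of fun i j => Algebra.trace ℚ K ((ζ ^ 11 * (aeval ζ (derivative (cyclotomic 84 ℚ)))⁻¹) * x i * IsCMField.complexConj K ((1 + 2 * ζ ^ 28) * x j)))
    (a' := Matrix.of fun i j => Algebra.trace ℚ K (𝓇 ϖ₀ * (ζ ^ 11 * (aeval ζ (derivative (cyclotomic 84 ℚ)))⁻¹) * x i * IsCMField.complexConj K ((1 + 2 * ζ ^ 28) * x j)))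
    (fun i j => rfl) (fun i j => by rw [Matrix.of_apply, e])
  have hD := det_realPart_xi_sqrtNegThree hζ hx
    (a := Matrix.of fun i j => Algebra.trace ℚ K ((ζ ^ 11 * (aeval ζ (derivative (cyclotomic 84 ℚ)))⁻¹) * x i * IsCMField.complexConj K ((1 + 2 * ζ ^ 28) * x j))) (fun i j => rfl)
  rw [hD] at hmul
  exact hmul

open scoped Classical in
/-- **CENSUS FORM OF THE LAW** (`K_d = ℚ(√−3)` at `84`): for EVERY real integer `ϖ₀` with `N_{K⁺/ℚ}(ϖ₀) > 0` and every CM type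
`Φ` of `ℚ(ζ_84)` balanced for `N_K = {5, 11, 17, 23, 29, 41, 47, 53, 59, 65, 71, 83}` (`s₃`-signature `(6,6)`), `ℂ^Φ/Φ(ℤ[ζ_84])` CARRIES a `Φ`-positive divisor of type
`(K; Φ; (ϖ₀))` (the norm-sign law, part 56f `exists_type_iff_norm_pos_eightyFour_sqrt_neg_three`) and EVERY such divisor has Gram determinant
`N(ϖ₀)·2985984` in the frame `θ^i` — class `[N(ϖ₀)]`: **every positive norm from `ℤ[ζ_84]⁺` is the component of a
`ℤ[ζ_84]`-CM point of Weil type, on every balanced CM type.**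
research route conditional on HC_CM; not a corollary; Q11.4-sentence-2 already refuted in dim ≥ 3. [cite: vanGeemen1994HodgeAV, Lemma 5.2 (3)–(4) and (5.4.1)] [cite: Shimura1998, §14.3 Prop. 4–5, pp. 103–104] -/
theorem exists_type_span_sqrtNegThree_det [IsCyclotomicExtension {84} ℚ K] [IsCMField K]
    (hζ : IsPrimitiveRoot ζ 84) (Φ : CMType K)
    (hbal : 2 * (SΦ[Φ, ζ] ∩ ({5, 11, 17, 23, 29, 41, 47, 53, 59, 65, 71, 83} : Finset (ZMod 84))).card = (SΦ[Φ, ζ]).card)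
    (ϖ₀ : 𝓞 (maximalRealSubfield K)) (hpos : 0 < Algebra.norm ℚ ((ϖ₀ : maximalRealSubfield K))) :
    ∃ ζ' : K, IsCMField.complexConj K ζ' = -ζ' ∧ (∀ φ : Φ.1, 0 < (φ.1 ζ').im) ∧
      CMTypeLattice.IsOfType (1 : (FractionalIdeal (𝓞 K)⁰ K)ˣ) ζ' (Ideal.span {ϖ₀}) ∧
      ∀ (x : Fin 12 → K), (∀ i, x i = (ζ + ζ⁻¹) ^ (i : ℕ)) → ∀ a : Matrix (Fin 12) (Fin 12) ℚ,
        (∀ i j, a i j = Algebra.trace ℚ K (ζ' * x i * IsCMField.complexConj K ((1 + 2 * ζ ^ 28) * x j))) →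
        a.det = Algebra.norm ℚ ((ϖ₀ : maximalRealSubfield K)) * 2985984 := by
  have hϖ0 : ϖ₀ ≠ 0 := by
    rintro rfl
    simp at hpos
  obtain ⟨ζ', h1, h2, h3⟩ := (exists_type_iff_norm_pos_eightyFour_sqrt_neg_three hζ Φ hbal hϖ0).mpr hpos
  exact ⟨ζ', h1, h2, h3, fun x hx a ha => det_realPart_type_span_sqrtNegThree hζ ϖ₀ hϖ0 h1 h3 hx ha⟩

/-- **`[N·2985984] = [N]` in `ℚˣ/Nm(ℚ(√−3)ˣ)`** for every rational `N ≠ 0` (`2985984 = det a(ξ, s₃)` is `1728² + 3·0²`, a norm): the class of a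
type-`(ϖ₀)` point is `[N_{K⁺/ℚ}(ϖ₀)]`, i.e. its census row is read off the norm alone (`T(N(ϖ₀))`).
research route conditional on HC_CM; not a corollary; Q11.4-sentence-2 already refuted in dim ≥ 3. [cite: vanGeemen1994HodgeAV, 5.4 and (5.4.1)] -/
theorem mk_mul_det_xi_sqrtNegThree (N : ℚ) (hN : N ≠ 0) :
    (QuotientGroup.mk (Units.mk0 (N * 2985984) (mul_ne_zero hN (by norm_num))) : weilNormResidueGroup 3) =
      QuotientGroup.mk (Units.mk0 N hN) := by
  rw [QuotientGroup.eq]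
  have e : (Units.mk0 (N * 2985984) (mul_ne_zero hN (by norm_num)))⁻¹ * Units.mk0 N hN =
      Units.mk0 ((1 / 2985984 : ℚ)) (by norm_num) := by
    ext
    simp only [Units.val_mul, Units.val_inv_eq_inv_val, Units.val_mk0]
    field_simp
  rw [e]
  exact mem_normUnitsSubgroup_of_sq_add_mul_sq _ ((1728 / 2985984) : ℚ) (0 : ℚ) (by norm_num)

/-! ### §3 `K_d = ℚ(√−7)` (`s = s₇`): the law `det a(ζ′) = N(ϖ₀)·481890304`, census form for every `N(ϖ₀) > 0`, class `[N(ϖ₀)]` -/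

/-- **THE COMPONENT LAW at `84` for `K_d = ℚ(√−7)`**: for EVERY real integer `ϖ₀ ≠ 0` of `ℚ(ζ_84)⁺` and EVERY skew `ζ′` of
type `(ϖ₀)` on `ℤ[ζ_84]` (`IsOfType 1 ζ′ (ϖ₀)`; `ζ′ = u·ϖ₀ξ`, `u` a real unit, `N(u) = 1` by THEOREM L (i) at `84`), the Gram
determinant of `(E_ζ′, s₇)` in the frame `θ^i` is **`N_{K⁺/ℚ}(ϖ₀)·481890304`** (`481890304 = det a(ξ, s₇)`, part 180): the point lies on
the class `[N(ϖ₀)]` of `ℚˣ/Nm(ℚ(√−7)ˣ)`.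
research route conditional on HC_CM; not a corollary; Q11.4-sentence-2 already refuted in dim ≥ 3. [cite: vanGeemen1994HodgeAV, Lemma 5.2 (3)–(4) and (5.4.1)] [cite: Shimura1998, §14.3 Prop. 4–5, pp. 103–104] -/
theorem det_realPart_type_span_sqrtNegSeven [IsCyclotomicExtension {84} ℚ K] [IsCMField K] (hζ : IsPrimitiveRoot ζ 84)
    (ϖ₀ : 𝓞 (maximalRealSubfield K)) (hϖ0 : ϖ₀ ≠ 0)
    {ζ' : K} (hζ' : IsCMField.complexConj K ζ' = -ζ')
    (hT : CMTypeLattice.IsOfType (1 : (FractionalIdeal (𝓞 K)⁰ K)ˣ) ζ' (Ideal.span {ϖ₀}))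
    {x : Fin 12 → K} (hx : ∀ i, x i = (ζ + ζ⁻¹) ^ (i : ℕ)) {a : Matrix (Fin 12) (Fin 12) ℚ}
    (ha : ∀ i j, a i j = Algebra.trace ℚ K (ζ' * x i * IsCMField.complexConj K ((1 + 2 * (ζ ^ 12 + ζ ^ 24 + ζ ^ 48)) * x j))) :
    a.det = Algebra.norm ℚ ((ϖ₀ : maximalRealSubfield K)) * 481890304 := by
  obtain ⟨ωb, hωb⟩ := exists_basis_thetaPow hζ
  have hx' : ∀ i, x i = (ωb i : K) := fun i => (hx i).trans (hωb i).symm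
  have hξ := complexConj_xi_eightyFour hζ
  have hsk := complexConj_realMul ϖ₀ hξ
  have h0 := mul_ne_zero (algebraMap_ringOfIntegers_ne_zero (K := K) hϖ0) (xi_ne_zero hζ 11)
  have hT₀ : CMTypeLattice.IsOfType (1 : (FractionalIdeal (𝓞 K)⁰ K)ˣ) (𝓇 ϖ₀ * (ζ ^ 11 * (aeval ζ (derivative (cyclotomic 84 ℚ)))⁻¹)) (Ideal.span {ϖ₀}) := by
    have h := isOfType_realMul (𝔪 := 1) ϖ₀ (isOfType_one_xi_top hζ 11)
    rwa [Ideal.mul_top] at h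
  rw [det_realPart_eq_of_isOfType ωb (complexConj_sqrtNegSeven hζ) hx' (norm_realUnits_pos_eightyFour hζ) hsk h0 hζ' hT₀ hT (fun i j => rfl) ha]
  obtain ⟨γ₀, hγ⟩ := exists_real_eq_mul_of_skew hξ (complexConj_sqrtNegSeven hζ)
  have e : ((ϖ₀ : maximalRealSubfield K) : K) = 𝓇 ϖ₀ := by
    rw [IsScalarTower.algebraMap_apply (𝓞 (maximalRealSubfield K)) (maximalRealSubfield K) K]
    rfl
  have hmul := det_realPart_mul ωb (complexConj_sqrtNegSeven hζ) hx' hγ (β₀ := (ϖ₀ : maximalRealSubfield K))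
    (a := Matrix.of fun i j => Algebra.trace ℚ K ((ζ ^ 11 * (aeval ζ (derivative (cyclotomic 84 ℚ)))⁻¹) * x i * IsCMField.complexConj K ((1 + 2 * (ζ ^ 12 + ζ ^ 24 + ζ ^ 48)) * x j)))
    (a' := Matrix.of fun i j => Algebra.trace ℚ K (𝓇 ϖ₀ * (ζ ^ 11 * (aeval ζ (derivative (cyclotomic 84 ℚ)))⁻¹) * x i * IsCMField.complexConj K ((1 + 2 * (ζ ^ 12 + ζ ^ 24 + ζ ^ 48)) * x j)))
    (fun i j => rfl) (fun i j => by rw [Matrix.of_apply, e])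
  have hD := det_realPart_xi_sqrtNegSeven hζ hx
    (a := Matrix.of fun i j => Algebra.trace ℚ K ((ζ ^ 11 * (aeval ζ (derivative (cyclotomic 84 ℚ)))⁻¹) * x i * IsCMField.complexConj K ((1 + 2 * (ζ ^ 12 + ζ ^ 24 + ζ ^ 48)) * x j))) (fun i j => rfl)
  rw [hD] at hmul
  exact hmul

open scoped Classical in
/-- **CENSUS FORM OF THE LAW** (`K_d = ℚ(√−7)` at `84`): for EVERY real integer `ϖ₀` with `N_{K⁺/ℚ}(ϖ₀) > 0` and every CM type
`Φ` of `ℚ(ζ_84)` balanced for `N_K = {5, 13, 17, 19, 31, 41, 47, 55, 59, 61, 73, 83}` (`s₇`-signature `(6,6)`), `ℂ^Φ/Φ(ℤ[ζ_84])` CARRIES a `Φ`-positive divisor of type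
`(K; Φ; (ϖ₀))` (the norm-sign law, part 56f `exists_type_iff_norm_pos_eightyFour_sqrt_neg_seven`) and EVERY such divisor has Gram determinant
`N(ϖ₀)·481890304` in the frame `θ^i` — class `[N(ϖ₀)]`: **every positive norm from `ℤ[ζ_84]⁺` is the component of a
`ℤ[ζ_84]`-CM point of Weil type, on every balanced CM type.**
research route conditional on HC_CM; not a corollary; Q11.4-sentence-2 already refuted in dim ≥ 3. [cite: vanGeemen1994HodgeAV, Lemma 5.2 (3)–(4) and (5.4.1)] [cite: Shimura1998, §14.3 Prop. 4–5, pp. 103–104] -/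
theorem exists_type_span_sqrtNegSeven_det [IsCyclotomicExtension {84} ℚ K] [IsCMField K]
    (hζ : IsPrimitiveRoot ζ 84) (Φ : CMType K)
    (hbal : 2 * (SΦ[Φ, ζ] ∩ ({5, 13, 17, 19, 31, 41, 47, 55, 59, 61, 73, 83} : Finset (ZMod 84))).card = (SΦ[Φ, ζ]).card)
    (ϖ₀ : 𝓞 (maximalRealSubfield K)) (hpos : 0 < Algebra.norm ℚ ((ϖ₀ : maximalRealSubfield K))) :
    ∃ ζ' : K, IsCMField.complexConj K ζ' = -ζ' ∧ (∀ φ : Φ.1, 0 < (φ.1 ζ').im) ∧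
      CMTypeLattice.IsOfType (1 : (FractionalIdeal (𝓞 K)⁰ K)ˣ) ζ' (Ideal.span {ϖ₀}) ∧
      ∀ (x : Fin 12 → K), (∀ i, x i = (ζ + ζ⁻¹) ^ (i : ℕ)) → ∀ a : Matrix (Fin 12) (Fin 12) ℚ,
        (∀ i j, a i j = Algebra.trace ℚ K (ζ' * x i * IsCMField.complexConj K ((1 + 2 * (ζ ^ 12 + ζ ^ 24 + ζ ^ 48)) * x j))) →
        a.det = Algebra.norm ℚ ((ϖ₀ : maximalRealSubfield K)) * 481890304 := by
  have hϖ0 : ϖ₀ ≠ 0 := by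
    rintro rfl
    simp at hpos
  obtain ⟨ζ', h1, h2, h3⟩ := (exists_type_iff_norm_pos_eightyFour_sqrt_neg_seven hζ Φ hbal hϖ0).mpr hpos
  exact ⟨ζ', h1, h2, h3, fun x hx a ha => det_realPart_type_span_sqrtNegSeven hζ ϖ₀ hϖ0 h1 h3 hx ha⟩

/-- **`[N·481890304] = [N]` in `ℚˣ/Nm(ℚ(√−7)ˣ)`** for every rational `N ≠ 0` (`481890304 = det a(ξ, s₇)` is `21952² + 7·0²`, a norm): the class of a
type-`(ϖ₀)` point is `[N_{K⁺/ℚ}(ϖ₀)]`, i.e. its census row is read off the norm alone (`T(N(ϖ₀))`).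
research route conditional on HC_CM; not a corollary; Q11.4-sentence-2 already refuted in dim ≥ 3. [cite: vanGeemen1994HodgeAV, 5.4 and (5.4.1)] -/
theorem mk_mul_det_xi_sqrtNegSeven (N : ℚ) (hN : N ≠ 0) :
    (QuotientGroup.mk (Units.mk0 (N * 481890304) (mul_ne_zero hN (by norm_num))) : weilNormResidueGroup 7) =
      QuotientGroup.mk (Units.mk0 N hN) := by
  rw [QuotientGroup.eq]
  have e : (Units.mk0 (N * 481890304) (mul_ne_zero hN (by norm_num)))⁻¹ * Units.mk0 N hN =
      Units.mk0 ((1 / 481890304 : ℚ)) (by norm_num) := by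
    ext
    simp only [Units.val_mul, Units.val_inv_eq_inv_val, Units.val_mk0]
    field_simp
  rw [e]
  exact mem_normUnitsSubgroup_of_sq_add_mul_sq _ ((21952 / 481890304) : ℚ) (0 : ℚ) (by norm_num)

/-! ### §4 `K_d = ℚ(√−21)` (`s = s₂₁`): the law `det a(ζ′) = N(ϖ₀)·351298031616`, census form for every `N(ϖ₀) > 0`, class `[N(ϖ₀)]` -/

/-- **THE COMPONENT LAW at `84` for `K_d = ℚ(√−21)`**: for EVERY real integer `ϖ₀ ≠ 0` of `ℚ(ζ_84)⁺` and EVERY skew `ζ′` of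
type `(ϖ₀)` on `ℤ[ζ_84]` (`IsOfType 1 ζ′ (ϖ₀)`; `ζ′ = u·ϖ₀ξ`, `u` a real unit, `N(u) = 1` by THEOREM L (i) at `84`), the Gram
determinant of `(E_ζ′, s₂₁)` in the frame `θ^i` is **`N_{K⁺/ℚ}(ϖ₀)·351298031616`** (`351298031616 = det a(ξ, s₂₁)`, part 181): the point lies on
the class `[N(ϖ₀)]` of `ℚˣ/Nm(ℚ(√−21)ˣ)`.
research route conditional on HC_CM; not a corollary; Q11.4-sentence-2 already refuted in dim ≥ 3. [cite: vanGeemen1994HodgeAV, Lemma 5.2 (3)–(4) and (5.4.1)] [cite: Shimura1998, §14.3 Prop. 4–5, pp. 103–104] -/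
theorem det_realPart_type_span_sqrtNegTwentyOne [IsCyclotomicExtension {84} ℚ K] [IsCMField K] (hζ : IsPrimitiveRoot ζ 84)
    (ϖ₀ : 𝓞 (maximalRealSubfield K)) (hϖ0 : ϖ₀ ≠ 0)
    {ζ' : K} (hζ' : IsCMField.complexConj K ζ' = -ζ')
    (hT : CMTypeLattice.IsOfType (1 : (FractionalIdeal (𝓞 K)⁰ K)ˣ) ζ' (Ideal.span {ϖ₀}))
    {x : Fin 12 → K} (hx : ∀ i, x i = (ζ + ζ⁻¹) ^ (i : ℕ)) {a : Matrix (Fin 12) (Fin 12) ℚ}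
    (ha : ∀ i j, a i j = Algebra.trace ℚ K (ζ' * x i * IsCMField.complexConj K ((ζ ^ 21 * (1 + 2 * ζ ^ 28) * (1 + 2 * (ζ ^ 12 + ζ ^ 24 + ζ ^ 48))) * x j))) :
    a.det = Algebra.norm ℚ ((ϖ₀ : maximalRealSubfield K)) * 351298031616 := by
  obtain ⟨ωb, hωb⟩ := exists_basis_thetaPow hζ
  have hx' : ∀ i, x i = (ωb i : K) := fun i => (hx i).trans (hωb i).symm
  have hξ := complexConj_xi_eightyFour hζ
  have hsk := complexConj_realMul ϖ₀ hξ
  have h0 := mul_ne_zero (algebraMap_ringOfIntegers_ne_zero (K := K) hϖ0) (xi_ne_zero hζ 11)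
  have hT₀ : CMTypeLattice.IsOfType (1 : (FractionalIdeal (𝓞 K)⁰ K)ˣ) (𝓇 ϖ₀ * (ζ ^ 11 * (aeval ζ (derivative (cyclotomic 84 ℚ)))⁻¹)) (Ideal.span {ϖ₀}) := by
    have h := isOfType_realMul (𝔪 := 1) ϖ₀ (isOfType_one_xi_top hζ 11)
    rwa [Ideal.mul_top] at h
  rw [det_realPart_eq_of_isOfType ωb (complexConj_sqrtNegTwentyOne hζ) hx' (norm_realUnits_pos_eightyFour hζ) hsk h0 hζ' hT₀ hT (fun i j => rfl) ha]
  obtain ⟨γ₀, hγ⟩ := exists_real_eq_mul_of_skew hξ (complexConj_sqrtNegTwentyOne hζ)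
  have e : ((ϖ₀ : maximalRealSubfield K) : K) = 𝓇 ϖ₀ := by
    rw [IsScalarTower.algebraMap_apply (𝓞 (maximalRealSubfield K)) (maximalRealSubfield K) K]
    rfl
  have hmul := det_realPart_mul ωb (complexConj_sqrtNegTwentyOne hζ) hx' hγ (β₀ := (ϖ₀ : maximalRealSubfield K))
    (a := Matrix.of fun i j => Algebra.trace ℚ K ((ζ ^ 11 * (aeval ζ (derivative (cyclotomic 84 ℚ)))⁻¹) * x i * IsCMField.complexConj K ((ζ ^ 21 * (1 + 2 * ζ ^ 28) * (1 + 2 * (ζ ^ 12 + ζ ^ 24 + ζ ^ 48))) * x j)))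
    (a' := Matrix.of fun i j => Algebra.trace ℚ K (𝓇 ϖ₀ * (ζ ^ 11 * (aeval ζ (derivative (cyclotomic 84 ℚ)))⁻¹) * x i * IsCMField.complexConj K ((ζ ^ 21 * (1 + 2 * ζ ^ 28) * (1 + 2 * (ζ ^ 12 + ζ ^ 24 + ζ ^ 48))) * x j)))
    (fun i j => rfl) (fun i j => by rw [Matrix.of_apply, e])
  have hD := det_realPart_xi_sqrtNegTwentyOne hζ hx
    (a := Matrix.of fun i j => Algebra.trace ℚ K ((ζ ^ 11 * (aeval ζ (derivative (cyclotomic 84 ℚ)))⁻¹) * x i * IsCMField.complexConj K ((ζ ^ 21 * (1 + 2 * ζ ^ 28) * (1 + 2 * (ζ ^ 12 + ζ ^ 24 + ζ ^ 48))) * x j))) (fun i j => rfl)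
  rw [hD] at hmul
  exact hmul

open scoped Classical in
/-- **CENSUS FORM OF THE LAW** (`K_d = ℚ(√−21)` at `84`): for EVERY real integer `ϖ₀` with `N_{K⁺/ℚ}(ϖ₀) > 0` and every CM type
`Φ` of `ℚ(ζ_84)` balanced for `N_K = {13, 29, 43, 47, 53, 59, 61, 65, 67, 73, 79, 83}` (`s₂₁`-signature `(6,6)`), `ℂ^Φ/Φ(ℤ[ζ_84])` CARRIES a `Φ`-positive divisor of type
`(K; Φ; (ϖ₀))` (the norm-sign law, part 56f `exists_type_iff_norm_pos_eightyFour_sqrt_neg_twentyOne`) and EVERY such divisor has Gram determinant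
`N(ϖ₀)·351298031616` in the frame `θ^i` — class `[N(ϖ₀)]`: **every positive norm from `ℤ[ζ_84]⁺` is the component of a
`ℤ[ζ_84]`-CM point of Weil type, on every balanced CM type.**
research route conditional on HC_CM; not a corollary; Q11.4-sentence-2 already refuted in dim ≥ 3. [cite: vanGeemen1994HodgeAV, Lemma 5.2 (3)–(4) and (5.4.1)] [cite: Shimura1998, §14.3 Prop. 4–5, pp. 103–104] -/
theorem exists_type_span_sqrtNegTwentyOne_det [IsCyclotomicExtension {84} ℚ K] [IsCMField K]
    (hζ : IsPrimitiveRoot ζ 84) (Φ : CMType K)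
    (hbal : 2 * (SΦ[Φ, ζ] ∩ ({13, 29, 43, 47, 53, 59, 61, 65, 67, 73, 79, 83} : Finset (ZMod 84))).card = (SΦ[Φ, ζ]).card)
    (ϖ₀ : 𝓞 (maximalRealSubfield K)) (hpos : 0 < Algebra.norm ℚ ((ϖ₀ : maximalRealSubfield K))) :
    ∃ ζ' : K, IsCMField.complexConj K ζ' = -ζ' ∧ (∀ φ : Φ.1, 0 < (φ.1 ζ').im) ∧
      CMTypeLattice.IsOfType (1 : (FractionalIdeal (𝓞 K)⁰ K)ˣ) ζ' (Ideal.span {ϖ₀}) ∧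
      ∀ (x : Fin 12 → K), (∀ i, x i = (ζ + ζ⁻¹) ^ (i : ℕ)) → ∀ a : Matrix (Fin 12) (Fin 12) ℚ,
        (∀ i j, a i j = Algebra.trace ℚ K (ζ' * x i * IsCMField.complexConj K ((ζ ^ 21 * (1 + 2 * ζ ^ 28) * (1 + 2 * (ζ ^ 12 + ζ ^ 24 + ζ ^ 48))) * x j))) →
        a.det = Algebra.norm ℚ ((ϖ₀ : maximalRealSubfield K)) * 351298031616 := by
  have hϖ0 : ϖ₀ ≠ 0 := by
    rintro rfl
    simp at hpos
  obtain ⟨ζ', h1, h2, h3⟩ := (exists_type_iff_norm_pos_eightyFour_sqrt_neg_twentyOne hζ Φ hbal hϖ0).mpr hpos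
  exact ⟨ζ', h1, h2, h3, fun x hx a ha => det_realPart_type_span_sqrtNegTwentyOne hζ ϖ₀ hϖ0 h1 h3 hx ha⟩

/-- **`[N·351298031616] = [N]` in `ℚˣ/Nm(ℚ(√−21)ˣ)`** for every rational `N ≠ 0` (`351298031616 = det a(ξ, s₂₁)` is `592704² + 21·0²`, a norm): the class of a
type-`(ϖ₀)` point is `[N_{K⁺/ℚ}(ϖ₀)]`, i.e. its census row is read off the norm alone (`T(N(ϖ₀))`).
research route conditional on HC_CM; not a corollary; Q11.4-sentence-2 already refuted in dim ≥ 3. [cite: vanGeemen1994HodgeAV, 5.4 and (5.4.1)] -/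
theorem mk_mul_det_xi_sqrtNegTwentyOne (N : ℚ) (hN : N ≠ 0) :
    (QuotientGroup.mk (Units.mk0 (N * 351298031616) (mul_ne_zero hN (by norm_num))) : weilNormResidueGroup 21) =
      QuotientGroup.mk (Units.mk0 N hN) := by
  rw [QuotientGroup.eq]
  have e : (Units.mk0 (N * 351298031616) (mul_ne_zero hN (by norm_num)))⁻¹ * Units.mk0 N hN =
      Units.mk0 ((1 / 351298031616 : ℚ)) (by norm_num) := by
    ext
    simp only [Units.val_mul, Units.val_inv_eq_inv_val, Units.val_mk0]
    field_simp
  rw [e]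
  exact mem_normUnitsSubgroup_of_sq_add_mul_sq _ ((592704 / 351298031616) : ℚ) (0 : ℚ) (by norm_num)

end Summit.HodgeConjecture.Ring2WeilCoverage.WeilGramLevel84TypeLaw

end
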